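import Summits.NavierStokesRegularity.FluidComputer.OccupationRestartFloor
import Summits.NavierStokesRegularity.FluidComputer.LevelOccupationWindow
import Summits.NavierStokesRegularity.FluidComputer.LevelOccupationFloor
import Literature.Analysis.FluidPDE.CheskidovDaiBootstrap
import Literature.Analysis.FluidPDE.LerayHopfBoundedWindowRegular
import HarnessLib

/-!
# The occupation floors of a blow-up, unconditionally

Summit NavierStokesRegularity / FluidComputer cell (pub-fluidc, machine paradigm; HONEST FRAMING: low prior, high
value-of-information experiment on Tao's machine paradigm; NOT a claim that NS blows up). The conditional floors of
`OccupationRestartFloor` and `LevelOccupationWindow` (`occupation_floor_lastHalf`, `occupation_floor_window`,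
`residence_floor_window`, `plain_occupation_floor_window`) carried the hypothesis `(h : cheskidov_dai_occupation_regular)`
— Cheskidov–Dai 2015, Thm. 1.1 (NSE, as printed) — and, for maximal smooth solutions, the standing hypothesis
`IsH1RegularOn (Ioo 0 T) u`. Both are now theorems of the tree: the named fact is
`Literature.Analysis.FluidPDE.cheskidov_dai_occupation_regular_holds` (`CheskidovDaiBootstrap.lean`), and a classical
solution on `ℝ³ × [0,T)` which is Leray–Hopf from `u 0` is `H¹`-regular on `(0,T)` with no further hypothesis
(`IsClassicalNSSolutionOn.isH1RegularOn_Ioo_of_isLerayHopfOn`, `LerayHopfBoundedWindowRegular.lean`: far-field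
ε-regularity plus continuity, then Leray's structure theorem). So the floors hold UNCONDITIONALLY: every maximal
smooth solution with finite lifespan `T` which is Leray–Hopf from `u 0` (finite energy) has level-occupation
integrals exceeding the absolute constant `c` at infinitely many levels inside every terminal window; and every
Leray–Hopf solution `H¹`-regular on `(0,T)` but not on `(0,T]` likewise (epoch form). The house-form floors of
`LevelOccupationFloor` / `OccupationWindowFloor` (hypothesis `cheskidov_dai_occupation`, rapidly decaying datum) are
instances through `cheskidov_dai_occupation_of_regular cheskidov_dai_occupation_regular_holds` (two are recorded at the end) and are
implied by the restart floors. 0 sorry.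
-/

noncomputable section

open MeasureTheory Filter Set Function Topology
open scoped ENNReal NNReal
open Literature.Analysis.FluidPDE Literature.Analysis.FunctionSpaces

namespace Summit.NavierStokesRegularity.FluidComputer.OccupationFloorsHold

/-- **The last-half occupation floor of a blow-up — unconditional**: there is an absolute `c > 0` such that every
maximal smooth solution `(u, p)` of the unforced Navier–Stokes system on `ℝ³ × [0,T)` with finite lifespan `T > 0`,
`ν > 0`, which is Leray–Hopf from `u 0`, has `c < limsup_q ∫_{(T/2,T)} 1_{2^q ≤ Λ_{c,ν}(u τ)} 2^q ‖Δ̇_q u(τ)‖_∞ dτ`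
(`OccupationRestartFloor.occupation_floor_lastHalf` with Cheskidov–Dai's Thm. 1.1 discharged by
`cheskidov_dai_occupation_regular_holds` and the `H¹`-regularity on `(0,T)` supplied by
`IsClassicalNSSolutionOn.isH1RegularOn_Ioo_of_isLerayHopfOn`). [cite: CheskidovDai2015, §1 Thm. 1.1] -/
theorem restart_occupation_floor_lastHalf :
    ∃ c : ℝ, 0 < c ∧ ∀ (ν T : ℝ), 0 < ν → 0 < T →
      ∀ (u : ℝ → EuclideanSpace ℝ (Fin 3) → EuclideanSpace ℝ (Fin 3)) (p : ℝ → EuclideanSpace ℝ (Fin 3) → ℝ),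
      IsMaximalSmoothSolution ν 0 u p T → IsLerayHopfOn T ν 0 (u 0) u →
      ENNReal.ofReal c < limsup (fun q : ℕ => ∫⁻ τ in Ioo (T / 2) T,
          {τ | (2 : ℝ≥0∞) ^ q ≤ dissipationWavenumber c ν (u τ)}.indicator
            (fun τ => (2 : ℝ≥0∞) ^ q * eLpNorm (blockFn (q : ℤ) (u τ)) ∞ volume) τ) atTop := by
  obtain ⟨c, hc, H⟩ := OccupationRestartFloor.occupation_floor_lastHalf cheskidov_dai_occupation_regular_holds
  exact ⟨c, hc, fun ν T hν hT u p hmax hLH =>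
    H ν T hν hT u p hmax hLH (hmax.1.isH1RegularOn_Ioo_of_isLerayHopfOn hν hT hLH)⟩

/-- **The occupation (clock) floor inside every terminal window — unconditional**: with an absolute `c > 0`, every
maximal smooth solution with finite lifespan `T`, Leray–Hopf from `u 0`, and every `t₀ ∈ [0,T)`:
`c < limsup_q ∫_{(t₀,T)} 1_{2^q ≤ Λ_{c,ν}(u τ)} 2^q ‖Δ̇_q u(τ)‖_∞ dτ` (`OccupationRestartFloor.occupation_floor_window`,
discharged as above). [cite: CheskidovDai2015, §1 Thm. 1.1] -/
theorem restart_occupation_floor_window :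
    ∃ c : ℝ, 0 < c ∧ ∀ (ν T : ℝ), 0 < ν → 0 < T →
      ∀ (u : ℝ → EuclideanSpace ℝ (Fin 3) → EuclideanSpace ℝ (Fin 3)) (p : ℝ → EuclideanSpace ℝ (Fin 3) → ℝ),
      IsMaximalSmoothSolution ν 0 u p T → IsLerayHopfOn T ν 0 (u 0) u →
      ∀ t₀ ∈ Ico 0 T,
      ENNReal.ofReal c < limsup (fun q : ℕ => ∫⁻ τ in Ioo t₀ T,
          {τ | (2 : ℝ≥0∞) ^ q ≤ dissipationWavenumber c ν (u τ)}.indicator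
            (fun τ => (2 : ℝ≥0∞) ^ q * eLpNorm (blockFn (q : ℤ) (u τ)) ∞ volume) τ) atTop := by
  obtain ⟨c, hc, H⟩ := OccupationRestartFloor.occupation_floor_window cheskidov_dai_occupation_regular_holds
  exact ⟨c, hc, fun ν T hν hT u p hmax hLH =>
    H ν T hν hT u p hmax hLH (hmax.1.isH1RegularOn_Ioo_of_isLerayHopfOn hν hT hLH)⟩

/-- **The residence (clock) floor inside every terminal window — unconditional**: in the same setting, at infinitely
many levels `q`, `c < 2^q · (sup_{t ∈ (t₀,T)} ‖Δ̇_q u(t)‖_∞) · |{t ∈ (t₀,T) : Λ_{c,ν}(u(t)) ≥ 2^q}|`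
(`OccupationRestartFloor.residence_floor_window`, discharged). [cite: CheskidovDai2015, §1 Thm. 1.1] -/
theorem restart_residence_floor_window :
    ∃ c : ℝ, 0 < c ∧ ∀ (ν T : ℝ), 0 < ν → 0 < T →
      ∀ (u : ℝ → EuclideanSpace ℝ (Fin 3) → EuclideanSpace ℝ (Fin 3)) (p : ℝ → EuclideanSpace ℝ (Fin 3) → ℝ),
      IsMaximalSmoothSolution ν 0 u p T → IsLerayHopfOn T ν 0 (u 0) u →
      ∀ t₀ ∈ Ico 0 T,
      ∃ᶠ q : ℕ in atTop, ENNReal.ofReal c <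
        (2 : ℝ≥0∞) ^ q * (⨆ τ ∈ Ioo t₀ T, eLpNorm (blockFn (q : ℤ) (u τ)) ∞ volume) *
          volume (Ioo t₀ T ∩ {τ | (2 : ℝ≥0∞) ^ q ≤ dissipationWavenumber c ν (u τ)}) := by
  obtain ⟨c, hc, H⟩ := OccupationRestartFloor.residence_floor_window cheskidov_dai_occupation_regular_holds
  exact ⟨c, hc, fun ν T hν hT u p hmax hLH =>
    H ν T hν hT u p hmax hLH (hmax.1.isH1RegularOn_Ioo_of_isLerayHopfOn hν hT hLH)⟩

/-- **The indicator-free clock inside every terminal window — unconditional**: in the same setting, at infinitely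
many levels `q`, `c < ∫_{(t₀,T)} 2^q ‖Δ̇_q u(τ)‖_∞ dτ` (`OccupationRestartFloor.plain_occupation_floor_window`,
discharged). [cite: CheskidovDai2015, §1 Thm. 1.1] -/
theorem restart_plain_occupation_floor_window :
    ∃ c : ℝ, 0 < c ∧ ∀ (ν T : ℝ), 0 < ν → 0 < T →
      ∀ (u : ℝ → EuclideanSpace ℝ (Fin 3) → EuclideanSpace ℝ (Fin 3)) (p : ℝ → EuclideanSpace ℝ (Fin 3) → ℝ),
      IsMaximalSmoothSolution ν 0 u p T → IsLerayHopfOn T ν 0 (u 0) u →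
      ∀ t₀ ∈ Ico 0 T,
      ∃ᶠ q : ℕ in atTop, ENNReal.ofReal c < ∫⁻ τ in Ioo t₀ T,
          (2 : ℝ≥0∞) ^ q * eLpNorm (blockFn (q : ℤ) (u τ)) ∞ volume := by
  obtain ⟨c, hc, H⟩ := OccupationRestartFloor.plain_occupation_floor_window cheskidov_dai_occupation_regular_holds
  exact ⟨c, hc, fun ν T hν hT u p hmax hLH =>
    H ν T hν hT u p hmax hLH (hmax.1.isH1RegularOn_Ioo_of_isLerayHopfOn hν hT hLH)⟩

/-- **The occupation floor on every terminal window of an epoch of irregularity — unconditional**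
(`LevelOccupationWindow.occupation_floor_window` with `cheskidov_dai_occupation_regular_holds`): every Leray–Hopf solution
which is `H¹`-regular on `(0,T)` but not on `(0,T]` has, for every `s ∈ [0,T)`,
`c < limsup_q ∫_{(s,T)} 1_{2^q ≤ Λ_{c,ν}(u τ)} 2^q ‖Δ̇_q u(τ)‖_∞ dτ`. [cite: CheskidovDai2015, §1 Thm. 1.1] -/
theorem epoch_occupation_floor_window :
    ∃ c : ℝ, 0 < c ∧ ∀ (ν T : ℝ), 0 < ν → 0 < T →
      ∀ (u₀ : EuclideanSpace ℝ (Fin 3) → EuclideanSpace ℝ (Fin 3))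
        (u : ℝ → EuclideanSpace ℝ (Fin 3) → EuclideanSpace ℝ (Fin 3)),
      IsLerayHopfOn T ν 0 u₀ u → IsH1RegularOn (Ioo 0 T) u → ¬ IsH1RegularOn (Ioc 0 T) u →
      ∀ s ∈ Ico 0 T, ENNReal.ofReal c <
        limsup (fun q : ℕ => ∫⁻ τ in Ioo s T,
          {τ | (2 : ℝ≥0∞) ^ q ≤ dissipationWavenumber c ν (u τ)}.indicator
            (fun τ => (2 : ℝ≥0∞) ^ q * eLpNorm (blockFn (q : ℤ) (u τ)) ∞ volume) τ) atTop :=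
  LevelOccupationWindow.occupation_floor_window cheskidov_dai_occupation_regular_holds

/-- **Frequently-large windowed occupation at an epoch of irregularity — unconditional**
(`LevelOccupationWindow.frequently_occupation_window_gt` with `cheskidov_dai_occupation_regular_holds`).
[cite: CheskidovDai2015, §1 Thm. 1.1] -/
theorem epoch_frequently_occupation_window_gt :
    ∃ c : ℝ, 0 < c ∧ ∀ (ν T : ℝ), 0 < ν → 0 < T →
      ∀ (u₀ : EuclideanSpace ℝ (Fin 3) → EuclideanSpace ℝ (Fin 3))
        (u : ℝ → EuclideanSpace ℝ (Fin 3) → EuclideanSpace ℝ (Fin 3)),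
      IsLerayHopfOn T ν 0 u₀ u → IsH1RegularOn (Ioo 0 T) u → ¬ IsH1RegularOn (Ioc 0 T) u →
      ∀ s ∈ Ico 0 T, ∃ᶠ q : ℕ in atTop, ENNReal.ofReal c <
        ∫⁻ τ in Ioo s T, {τ | (2 : ℝ≥0∞) ^ q ≤ dissipationWavenumber c ν (u τ)}.indicator
          (fun τ => (2 : ℝ≥0∞) ^ q * eLpNorm (blockFn (q : ℤ) (u τ)) ∞ volume) τ :=
  LevelOccupationWindow.frequently_occupation_window_gt cheskidov_dai_occupation_regular_holds

/-! ### The house-form floors (rapidly decaying datum), discharged -/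

/-- **The last-half occupation floor, house form — unconditional** (`LevelOccupationFloor.occupation_floor` with the
house form `cheskidov_dai_occupation` discharged by `cheskidov_dai_occupation_of_regular cheskidov_dai_occupation_regular_holds`;
implied by `restart_occupation_floor_lastHalf`, recorded for the users of `LevelOccupationFloor`). [cite: CheskidovDai2015, §1 Thm. 1.1] -/
theorem decay_occupation_floor_lastHalf :
    ∃ c : ℝ, 0 < c ∧ ∀ (ν T : ℝ), 0 < ν → 0 < T →
      ∀ (u : ℝ → EuclideanSpace ℝ (Fin 3) → EuclideanSpace ℝ (Fin 3))
        (p : ℝ → EuclideanSpace ℝ (Fin 3) → ℝ),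
      IsMaximalSmoothSolution ν 0 u p T → IsLerayHopfOn T ν 0 (u 0) u → HasRapidSpatialDecay (u 0) →
      ENNReal.ofReal c < limsup (fun q : ℕ => ∫⁻ τ in Ioo (T / 2) T,
          {τ | (2 : ℝ≥0∞) ^ q ≤ dissipationWavenumber c ν (u τ)}.indicator
            (fun τ => (2 : ℝ≥0∞) ^ q * eLpNorm (blockFn (q : ℤ) (u τ)) ∞ volume) τ) atTop :=
  LevelOccupationFloor.occupation_floor
    (cheskidov_dai_occupation_of_regular cheskidov_dai_occupation_regular_holds)

/-- **The residence floor in energy currency — unconditional** (`LevelOccupationFloor.residence_floor_energy`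
discharged the same way): with absolute `c > 0` and `C`, every maximal smooth solution with finite lifespan `T`,
Leray–Hopf from its rapidly decaying datum, has `c < C · 2^{5q/2} · ‖u(0)‖_{L²} · |(T/2,T) ∩ {Λ_{c,ν}(u(t)) ≥ 2^q}|`
at infinitely many `q`. [cite: CheskidovDai2015, §1 Thm. 1.1] -/
theorem decay_residence_floor_energy :
    ∃ c : ℝ, 0 < c ∧ ∃ C : ℝ≥0, ∀ (ν T : ℝ), 0 < ν → 0 < T →
      ∀ (u : ℝ → EuclideanSpace ℝ (Fin 3) → EuclideanSpace ℝ (Fin 3))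
        (p : ℝ → EuclideanSpace ℝ (Fin 3) → ℝ),
      IsMaximalSmoothSolution ν 0 u p T → IsLerayHopfOn T ν 0 (u 0) u → HasRapidSpatialDecay (u 0) →
      ∃ᶠ q : ℕ in atTop, ENNReal.ofReal c <
        C * (2 : ℝ≥0∞) ^ ((q : ℝ) * (5 / 2)) * eLpNorm (u 0) 2 volume *
          volume (Ioo (T / 2) T ∩ {τ | (2 : ℝ≥0∞) ^ q ≤ dissipationWavenumber c ν (u τ)}) :=
  LevelOccupationFloor.residence_floor_energy
    (cheskidov_dai_occupation_of_regular cheskidov_dai_occupation_regular_holds)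

end Summit.NavierStokesRegularity.FluidComputer.OccupationFloorsHold

end
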